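import Mathlib
import HarnessLib

/-!
# `stub_parentSplit` (U1b) of line `registered` (crux `NoCriticalTorusGiant`,
# stmt-CriticalPhenomena-5407): two large almost-disjoint rooted pieces of a parent forest

Registered stub `stub_parentSplit` of the lead's skeleton
`Cruxes/NoCriticalTorusGiant/Lines/birth.lean` (reshape c3, stub U1b of the sprinkling-free
doubling inequality `P(∃ cluster ≥ 3k) ≤ P(∃ cluster ≥ k)²`).

Statement: for `1 ≤ k`, `3k ≤ m` and a parent function `π : ℕ → ℕ` with `π i < i` for
`0 < i < m`, there are finite sets `A ∋ a`, `B ∋ b` of indices `< m`, each of size `≥ k`, with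
`a ≤ i` on `A`, `b ≤ i` on `B`, `π`-closed away from their roots (`π i ∈ A` for `i ∈ A ∖ {a}`,
`π i ∈ B` for `i ∈ B ∖ {b}`), and with `A ∖ {a}` and `B ∖ {b}` disjoint.

Proof (pure combinatorics on `ℕ`, Mathlib only).  Let `r x y :↔ y < x ∧ x < m ∧ π x = y` be the
parent-step relation (right-unique and decreasing) and `D c := {j < m | ReflTransGen r j c}` the
descendant set of `c` (`c ∈ D c` for `c < m`; elements of `D c` are `≥ c`).  Every `j < m`
descends from `0`, so `|D 0| = m ≥ k`; let `i₀` be the LARGEST `c < m` with `|D c| ≥ k`.  Its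
children `c` (`r c i₀`) have `|D c| ≤ k - 1` by maximality, their descendant sets are pairwise
disjoint (chains of a right-unique relation from a common point are comparable,
`U1b.child_eq_of_reflTransGen`), and `D i₀ ∖ {i₀}` is their union (last step of a chain), so
`Σ_children |D c| = |D i₀| - 1 ≥ k - 1`.  Adding children one at a time until the running sum
reaches `k - 1` (`U1b.exists_subset_le_sum_le`) gives a set `t` of children with
`k - 1 ≤ Σ_{c ∈ t} |D c| ≤ 2k - 2`.  Put `E := ⋃_{c ∈ t} D c`, `A := {i₀} ∪ E`, `a := i₀`,
`B := {0, …, m-1} ∖ E`, `b := 0`: `|A| = 1 + |E| ≥ k`, `|B| = m - |E| ≥ 3k - (2k - 2) ≥ k`,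
elements of `E` are `> i₀ ≥ 0`, `π` maps `D c ∖ {c}` into `D c` and a child `c` to `i₀ = a`, and
`i ∉ E`, `0 < i < m` forces `π i ∉ E` (a chain from `π i` extends to one from `i`); finally
`A ∖ {a} = E` is disjoint from `B ⊆ {0, …, m-1} ∖ E`.
-/

namespace Summit.CriticalPhenomena.PercolationContinuityZ3.Theorems.PercTorusSliceFillingNoCriticalTorusGiant

namespace U1b

open Relation

/-- Subset selection with bounded overshoot: if `f i ≤ K` on `s` and `T ≤ ∑_{i ∈ s} f i`, then
some `t ⊆ s` has `T ≤ ∑_{i ∈ t} f i ≤ T + K` (insert the elements of `s` one at a time and stop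
as soon as the running sum reaches `T`; induction on `s`). -/
theorem exists_subset_le_sum_le {ι : Type*} [DecidableEq ι] (f : ι → ℕ) (K T : ℕ)
    (s : Finset ι) (hf : ∀ i ∈ s, f i ≤ K) (hT : T ≤ ∑ i ∈ s, f i) :
    ∃ t ⊆ s, T ≤ ∑ i ∈ t, f i ∧ ∑ i ∈ t, f i ≤ T + K := by
  induction s using Finset.induction_on with
  | empty =>
    refine ⟨∅, subset_rfl, hT, ?_⟩
    rw [Finset.sum_empty]
    exact Nat.zero_le _
  | insert a s ha ih =>
    rw [Finset.sum_insert ha] at hT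
    by_cases h : T ≤ ∑ i ∈ s, f i
    · obtain ⟨t, hts, h1, h2⟩ := ih (fun i hi => hf i (Finset.mem_insert_of_mem hi)) h
      exact ⟨t, hts.trans (Finset.subset_insert a s), h1, h2⟩
    · refine ⟨insert a s, subset_rfl, ?_, ?_⟩
      · rw [Finset.sum_insert ha]
        exact hT
      · rw [Finset.sum_insert ha]
        have hfa := hf a (Finset.mem_insert_self a s)
        omega

variable {r : ℕ → ℕ → Prop}

/-- Along a chain of a decreasing relation on `ℕ` the endpoint lies below the start. -/
theorem le_of_reflTransGen (hdec : ∀ x y, r x y → y < x) {j c : ℕ} (h : ReflTransGen r j c) :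
    c ≤ j := by
  induction h with
  | refl => exact le_rfl
  | tail _ hbc ih => exact (Nat.le_of_lt (hdec _ _ hbc)).trans ih

/-- For a right-unique decreasing relation on `ℕ`, two children `c, c'` of a common parent `p`
(`r c p`, `r c' p`) that are both reached from one point `j` coincide: the two chains from `j`
are comparable (`ReflTransGen.total_of_right_unique`), and a nontrivial chain from one child to
the other passes through `p`, forcing `c' ≤ p < c'`. -/
theorem child_eq_of_reflTransGen (hU : Relator.RightUnique r) (hdec : ∀ x y, r x y → y < x)
    {j c c' p : ℕ} (hc : r c p) (hc' : r c' p) (hj : ReflTransGen r j c)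
    (hj' : ReflTransGen r j c') : c = c' := by
  have key : ∀ {u v : ℕ}, r u p → r v p → ReflTransGen r u v → u = v := by
    intro u v hu hv huv
    rcases huv.cases_head with h | ⟨d, hud, hdv⟩
    · exact h
    · have hdp : d = p := hU hud hu
      rw [hdp] at hdv
      have h1 := le_of_reflTransGen hdec hdv
      have h2 := hdec _ _ hv
      omega
  rcases ReflTransGen.total_of_right_unique hU hj hj' with h | h
  · exact key hc hc' h
  · exact (key hc' hc h).symm

end U1b

/-- **U1b — two large almost-disjoint rooted pieces of a parent forest** (registered stub
`stub_parentSplit` of `Cruxes/NoCriticalTorusGiant/Lines/birth.lean`).  For `1 ≤ k`, `3k ≤ m`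
and a parent function `π` with `π i < i` for `0 < i < m`, the index set `{0, …, m-1}` contains
two rooted `π`-closed pieces `A ∋ a`, `B ∋ b` (roots minimal, `π i ∈ A` for `i ∈ A ∖ {a}`,
`π i ∈ B` for `i ∈ B ∖ {b}`), each of size `≥ k`, whose non-root parts are disjoint.
Construction: `a := i₀`, the largest index whose descendant set has `≥ k` elements;
`A := {i₀} ∪ E` with `E` the union of the descendant sets of a family of children of `i₀` of
total size in `[k - 1, 2k - 2]` (each child has `< k` descendants by maximality); `b := 0`,
`B := {0, …, m-1} ∖ E`.  See the module docstring. -/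
theorem stub_parentSplit : ∀ (m k : ℕ) (π : ℕ → ℕ), 1 ≤ k → 3 * k ≤ m → (∀ i, 0 < i → i < m → π i < i) → ∃ (A B : Finset ℕ) (a b : ℕ), a ∈ A ∧ b ∈ B ∧ k ≤ A.card ∧ k ≤ B.card ∧ (∀ i ∈ A, i < m) ∧ (∀ i ∈ B, i < m) ∧ (∀ i ∈ A, a ≤ i) ∧ (∀ i ∈ B, b ≤ i) ∧ (∀ i ∈ A, i ≠ a → π i ∈ A) ∧ (∀ i ∈ B, i ≠ b → π i ∈ B) ∧ Disjoint (A.erase a) (B.erase b) := by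
  intro m k π hk hkm hπ
  classical
  have hmk : k ≤ m := by omega
  have hm0 : 0 < m := by omega
  -- the parent-step relation: `r x y` iff `y = π x` is the parent of `x`, `0 < x < m`
  obtain ⟨r, hU, hdec, hback, hstep⟩ : ∃ r : ℕ → ℕ → Prop, Relator.RightUnique r ∧
      (∀ x y, r x y → y < x) ∧ (∀ x y, r x y → x < m ∧ π x = y) ∧
      (∀ x, 0 < x → x < m → r x (π x)) :=
    ⟨fun x y => y < x ∧ x < m ∧ π x = y, fun x y z h h' => h.2.2.symm.trans h'.2.2,
      fun x y h => h.1, fun x y h => h.2, fun x hx hxm => ⟨hπ x hx hxm, hxm, rfl⟩⟩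
  -- descendant sets `D c = {j < m | c is an iterated parent of j}` (`c ∈ D c` for `c < m`)
  obtain ⟨D, hD⟩ : ∃ D : ℕ → Finset ℕ, ∀ c j, j ∈ D c ↔ j < m ∧ Relation.ReflTransGen r j c :=
    ⟨fun c => (Finset.range m).filter (fun j => Relation.ReflTransGen r j c), fun c j => by simp⟩
  have hDle : ∀ {c j}, j ∈ D c → c ≤ j := fun h => U1b.le_of_reflTransGen hdec ((hD _ _).1 h).2
  have hDself : ∀ {c}, c < m → c ∈ D c := fun hc => (hD _ _).2 ⟨hc, Relation.ReflTransGen.refl⟩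
  have hDsub : ∀ c, D c ⊆ Finset.range m := fun c j hj => Finset.mem_range.2 ((hD _ _).1 hj).1
  -- every `j < m` descends from `0`, so `D 0 = {0, …, m-1}`
  have hD0 : D 0 = Finset.range m := by
    refine Finset.Subset.antisymm (hDsub 0) ?_
    intro j hj
    rw [Finset.mem_range] at hj
    refine (hD 0 j).2 ⟨hj, ?_⟩
    induction j using Nat.strong_induction_on with
    | _ j ih =>
      rcases Nat.eq_zero_or_pos j with rfl | hj0
      · exact Relation.ReflTransGen.refl
      · exact Relation.ReflTransGen.head (hstep j hj0 hj)
          (ih (π j) (hπ j hj0 hj) ((hπ j hj0 hj).trans hj))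
  -- `i₀` := the largest index `< m` whose descendant set has at least `k` elements
  obtain ⟨i₀, hi₀m, hi₀k, hi₀max⟩ :
      ∃ i₀, i₀ < m ∧ k ≤ (D i₀).card ∧ ∀ c, c < m → k ≤ (D c).card → c ≤ i₀ := by
    let S : Finset ℕ := (Finset.range m).filter (fun c => k ≤ (D c).card)
    have hS0 : 0 ∈ S := by
      simp only [S, Finset.mem_filter, Finset.mem_range, hD0, Finset.card_range]
      exact ⟨hm0, hmk⟩
    have hSne : S.Nonempty := ⟨0, hS0⟩
    have hmem := S.max'_mem hSne
    simp only [S, Finset.mem_filter, Finset.mem_range] at hmem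
    refine ⟨S.max' hSne, hmem.1, hmem.2, fun c hc hck => S.le_max' c ?_⟩
    simp only [S, Finset.mem_filter, Finset.mem_range]
    exact ⟨hc, hck⟩
  -- the children of `i₀`; by maximality of `i₀` each has at most `k - 1` descendants
  obtain ⟨Ch, hCh⟩ : ∃ Ch : Finset ℕ, ∀ c, c ∈ Ch ↔ r c i₀ :=
    ⟨(Finset.range m).filter (fun c => r c i₀), fun c => by
      simp only [Finset.mem_filter, Finset.mem_range, and_iff_right_iff_imp]
      exact fun h => (hback c i₀ h).1⟩
  have hChlt : ∀ c ∈ Ch, (D c).card ≤ k - 1 := by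
    intro c hc
    have hr := (hCh c).1 hc
    have hic : i₀ < c := hdec _ _ hr
    have hcm : c < m := (hback _ _ hr).1
    by_contra h
    have := hi₀max c hcm (by omega)
    omega
  -- distinct children have disjoint descendant sets
  have hdisj : (Ch : Set ℕ).PairwiseDisjoint D := by
    intro c hc c' hc' hne
    change Disjoint (D c) (D c')
    rw [Finset.disjoint_left]
    intro j hj hj'
    exact hne (U1b.child_eq_of_reflTransGen hU hdec ((hCh c).1 hc) ((hCh c').1 hc')
      ((hD c j).1 hj).2 ((hD c' j).1 hj').2)
  -- `D i₀ ∖ {i₀}` is the union of the children's descendant sets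
  have hcover : (D i₀).erase i₀ = Ch.biUnion D := by
    ext j
    simp only [Finset.mem_erase, Finset.mem_biUnion]
    constructor
    · rintro ⟨hne, hj⟩
      obtain ⟨hjm, hjr⟩ := (hD i₀ j).1 hj
      rcases hjr.cases_tail with h | ⟨c, hjc, hci⟩
      · exact absurd h.symm hne
      · exact ⟨c, (hCh c).2 hci, (hD c j).2 ⟨hjm, hjc⟩⟩
    · rintro ⟨c, hc, hj⟩
      have hr := (hCh c).1 hc
      obtain ⟨hjm, hjc⟩ := (hD c j).1 hj
      refine ⟨?_, (hD i₀ j).2 ⟨hjm, hjc.tail hr⟩⟩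
      have h1 := hdec _ _ hr
      have h2 := U1b.le_of_reflTransGen hdec hjc
      omega
  have hsum : k - 1 ≤ ∑ c ∈ Ch, (D c).card := by
    rw [← Finset.card_biUnion hdisj, ← hcover, Finset.card_erase_of_mem (hDself hi₀m)]
    omega
  -- a family `t` of children with total descendant count in `[k - 1, 2k - 2]`
  obtain ⟨t, htCh, ht1, ht2⟩ :=
    U1b.exists_subset_le_sum_le (fun c => (D c).card) (k - 1) (k - 1) Ch hChlt hsum
  have htdisj : (t : Set ℕ).PairwiseDisjoint D := hdisj.subset (Finset.coe_subset.2 htCh)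
  have hEcard : (t.biUnion D).card = ∑ c ∈ t, (D c).card := Finset.card_biUnion htdisj
  have hEsub : t.biUnion D ⊆ Finset.range m :=
    Finset.biUnion_subset.2 (fun c _ => hDsub c)
  -- elements of `E = ⋃_{c ∈ t} D c` lie strictly above `i₀`
  have hEgt : ∀ j ∈ t.biUnion D, i₀ < j := by
    intro j hj
    obtain ⟨c, hc, hjc⟩ := Finset.mem_biUnion.1 hj
    have h1 := hdec _ _ ((hCh c).1 (htCh hc))
    have h2 := hDle hjc
    omega
  have hi₀E : i₀ ∉ t.biUnion D := fun h => lt_irrefl _ (hEgt _ h)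
  have h0E : 0 ∉ t.biUnion D := fun h => Nat.not_lt_zero _ (hEgt 0 h)
  refine ⟨insert i₀ (t.biUnion D), Finset.range m \ t.biUnion D, i₀, 0,
    Finset.mem_insert_self _ _, ?_, ?_, ?_, ?_, ?_, ?_, ?_, ?_, ?_, ?_⟩
  · -- `b = 0 ∈ B`
    exact Finset.mem_sdiff.2 ⟨Finset.mem_range.2 hm0, h0E⟩
  · -- `k ≤ |A| = |E| + 1`
    rw [Finset.card_insert_of_notMem hi₀E, hEcard]
    omega
  · -- `k ≤ |B| = m - |E|`
    rw [Finset.card_sdiff_of_subset hEsub, Finset.card_range, hEcard]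
    omega
  · -- `A ⊆ {0, …, m-1}`
    intro i hi
    rcases Finset.mem_insert.1 hi with rfl | hi
    · exact hi₀m
    · exact Finset.mem_range.1 (hEsub hi)
  · -- `B ⊆ {0, …, m-1}`
    intro i hi
    exact Finset.mem_range.1 (Finset.sdiff_subset hi)
  · -- `a = i₀ ≤ i` on `A`
    intro i hi
    rcases Finset.mem_insert.1 hi with rfl | hi
    · exact le_rfl
    · exact Nat.le_of_lt (hEgt i hi)
  · -- `b = 0 ≤ i` on `B`
    intro i _
    exact Nat.zero_le i
  · -- `π`-closure of `A` away from `a`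
    intro i hi hne
    have hiE : i ∈ t.biUnion D := (Finset.mem_insert.1 hi).resolve_left hne
    obtain ⟨c, hc, hic⟩ := Finset.mem_biUnion.1 hiE
    obtain ⟨him, hir⟩ := (hD c i).1 hic
    rcases hir.cases_head with rfl | ⟨d, hid, hdc⟩
    · -- `i` is a child of `i₀`: its parent is `i₀ = a`
      rw [(hback _ _ ((hCh _).1 (htCh hc))).2]
      exact Finset.mem_insert_self _ _
    · -- the parent `d = π i` of `i` is again a descendant of `c`
      obtain ⟨-, hπi⟩ := hback _ _ hid
      rw [hπi]
      refine Finset.mem_insert_of_mem (Finset.mem_biUnion.2 ⟨c, hc, (hD c d).2 ⟨?_, hdc⟩⟩)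
      exact (hdec _ _ hid).trans him
  · -- `π`-closure of `B` away from `b = 0`
    intro i hi hne
    obtain ⟨him, hiE⟩ := Finset.mem_sdiff.1 hi
    rw [Finset.mem_range] at him
    have hi0 : 0 < i := Nat.pos_of_ne_zero hne
    have hπi := hπ i hi0 him
    refine Finset.mem_sdiff.2 ⟨Finset.mem_range.2 (hπi.trans him), fun hπE => hiE ?_⟩
    obtain ⟨c, hc, hπc⟩ := Finset.mem_biUnion.1 hπE
    exact Finset.mem_biUnion.2
      ⟨c, hc, (hD c i).2 ⟨him, Relation.ReflTransGen.head (hstep i hi0 him) ((hD c _).1 hπc).2⟩⟩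
  · -- `A ∖ {a} = E` is disjoint from `B ∖ {b} ⊆ {0, …, m-1} ∖ E`
    rw [Finset.erase_insert hi₀E]
    exact Finset.disjoint_sdiff.mono_right (Finset.erase_subset _ _)

end Summit.CriticalPhenomena.PercolationContinuityZ3.Theorems.PercTorusSliceFillingNoCriticalTorusGiant
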